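import Summits.QuantumFields.BalabanUV.T4Continuum.E3Cert.E3PolyCertZDefs

/-!
# E3 lean-draft (SPARSE-MONOMIAL, INTEGER-COEFFICIENT variant E3Z: all kernel arithmetic in ℤ — no ℚ normalisation in the kernel): kernel replay of an E3 matrix-Putinar certificate as ONE scalar polynomial identity (lane balaban-calc, engine E3)

DRAFT under `run/shared/lean/ttrl/balaban-calc/e3/lean-draft/` — NOT a tree file (handed to ttrl2).  Object: for the block operator
`H(x)` of B4 CMP 89 (1.3)–(1.6) (entries polynomial in the free-link quaternion coordinates `x`), the certificate JSON
`e3/certs/<name>.json` (schema v3/v4, verified by `bal_e3_verify.py`) is re-encoded by `bal_e3_lean_emit.py` as data and the claim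
becomes the polynomial identity in the variables `X = (x, v)` (`v` = a test vector of length `dim`):

  `vᵀ H(x) v − γ |v|²  =  Σ_k D_k · ℓ_k(x,v)²  +  Σ_t g_t(x) · Σ_k D'_{t,k} · ℓ'_{t,k}(v)²  +  Σ_t (|x_t|² − 1) · W_t(x,v)`      (★)

with `D_k, D'_{t,k} ≥ 0`, `ℓ, ℓ'` explicit polynomials with rational coefficients, `g_t` the small-field hypotheses and `W_t` free.
On `{|x_t|² = 1 ∀t, g_t ≥ 0 ∀t}` the right-hand side of (★) is `≥ 0`, i.e. `vᵀH(x)v ≥ γ|v|²` for every `v`: `λ_min(H(x)) ≥ γ`.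

KERNEL CHECK (`decide +kernel` on literal data; no `native_decide`, no axioms): `PolyCert.check c = true`, where `check` expands both sides
of (★) into sparse polynomials over ℚ, merge-sorts the residual LHS − RHS with coefficient accumulation (fuelled structural recursion) and tests
that every coefficient is 0, and tests `D ≥ 0`.  SOUNDNESS `PolyCert.check_sound` is PROVED below (no sorry):
`check c = true → ∀ X, (∀ t, sphere_t(X) = 0) → (∀ t, 0 ≤ g_t(X)) → 0 ≤ eval X (lhs c)`, and `eval X (lhs c) = eval X c.quadH − γ·eval X c.vSq`.
-/

set_option autoImplicit false
/-! TREE COPY (substrate cell E3 PILOT, typer ruling (μ3), journal l.19196): part 2∕3 = the EVALUATION LEMMAS (`namespace Poly`: `eval_*`, merge∕sort∕slice soundness, square∕inequality∕equation sums) of the lane checker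
`run/shared/lean/ttrl/balaban-calc/e3/lean-draft/tree/E3PolyCertZ.lean` (split at namespace seams for the tree's 400-line rule; one-line docstrings
added by script to undocumented declarations; NO other edit — in particular no literal, definition body or proof is changed).  HONEST: a
certificate CHECKER; the mathematics it serves is certified computation on small blocks ([B4] (1.3)–(1.6) block forms) — NOT Prop. (1.8), NOT an
input of any NE row today, NOT infinite volume ∕ mass gap ∕ Clay. -/

namespace E3Z

/-! ## Soundness -/
namespace Poly
variable (X : ℕ → ℝ)

/-- E3Z checker (evaluation lemmas): `evalMono_append` (lane output, transcribed verbatim; see the module docstring). -/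
theorem evalMono_append (a b : Mono) : evalMono X (a ++ b) = evalMono X a * evalMono X b := by
  induction a with
  | nil => simp [evalMono]
  | cons x a ih => simp only [List.cons_append, evalMono, ih]; ring

/-- E3Z checker (evaluation lemmas): `evalMono_addMonoF` (lane output, transcribed verbatim; see the module docstring). -/
theorem evalMono_addMonoF (f : ℕ) (a b : Mono) : evalMono X (addMonoF f a b) = evalMono X a * evalMono X b := by
  induction f generalizing a b with
  | zero => simp [addMonoF, evalMono_append]
  | succ f ih =>
    cases a with
    | nil => cases b <;> simp [addMonoF, evalMono]
    | cons x a =>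
      cases b with
      | nil => simp [addMonoF, evalMono]
      | cons y b =>
        obtain ⟨v, e⟩ := x; obtain ⟨w, e'⟩ := y
        simp only [addMonoF]
        by_cases h1 : v < w
        · rw [if_pos h1]; simp only [evalMono, ih]; ring
        · rw [if_neg h1]
          by_cases h2 : w < v
          · rw [if_pos h2]; simp only [evalMono, ih]; ring
          · rw [if_neg h2]; simp only [evalMono, ih]
            have hvw : v = w := by omega
            subst hvw; rw [pow_add]; ring

/-- E3Z checker (evaluation lemmas): `evalMono_addMono` (lane output, transcribed verbatim; see the module docstring). -/
theorem evalMono_addMono (a b : Mono) : evalMono X (addMono a b) = evalMono X a * evalMono X b :=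
  evalMono_addMonoF X _ a b

/-- E3Z checker (evaluation lemmas): `eval_append` (lane output, transcribed verbatim; see the module docstring). -/
theorem eval_append (p q : Poly) : eval X (p ++ q) = eval X p + eval X q := by
  induction p with
  | nil => simp [eval]
  | cons a t ih => simp only [List.cons_append, eval, ih]; ring

/-- E3Z checker (evaluation lemmas): `eval_add` (lane output, transcribed verbatim; see the module docstring). -/
theorem eval_add (p q : Poly) : eval X (add p q) = eval X p + eval X q := eval_append X p q

/-- E3Z checker (evaluation lemmas): `eval_neg` (lane output, transcribed verbatim; see the module docstring). -/
theorem eval_neg (p : Poly) : eval X (neg p) = - eval X p := by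
  induction p with
  | nil => simp [eval, neg]
  | cons a t ih => simp only [neg, List.map_cons, eval] at ih ⊢; rw [ih]; push_cast; ring

/-- E3Z checker (evaluation lemmas): `eval_smul` (lane output, transcribed verbatim; see the module docstring). -/
theorem eval_smul (c : ℤ) (p : Poly) : eval X (smul c p) = (c : ℝ) * eval X p := by
  induction p with
  | nil => simp [eval, smul]
  | cons a t ih => simp only [smul, List.map_cons, eval] at ih ⊢; rw [ih]; push_cast; ring

/-- E3Z checker (evaluation lemmas): `evalMono_renorm` (lane output, transcribed verbatim; see the module docstring). -/
theorem evalMono_renorm (m : Mono) : evalMono X (m.map (fun ve => (ve.1 + 0, ve.2 + 0))) = evalMono X m := by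
  have : (fun ve : ℕ × ℕ => (ve.1 + 0, ve.2 + 0)) = id := by funext ve; simp
  rw [this, List.map_id]

/-- E3Z checker (evaluation lemmas): `eval_renorm` (lane output, transcribed verbatim; see the module docstring). -/
theorem eval_renorm (p : Poly) : eval X (renorm p) = eval X p := by
  induction p with
  | nil => simp [eval, renorm]
  | cons a t ih => simp only [renorm, List.map_cons, eval] at ih ⊢; rw [ih, evalMono_renorm]; simp

/-- E3Z checker (evaluation lemmas): `eval_mulMono` (lane output, transcribed verbatim; see the module docstring). -/
theorem eval_mulMono (a : Mono × ℤ) (q : Poly) : eval X (mulMono a q) = (a.2 : ℝ) * evalMono X a.1 * eval X q := by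
  induction q with
  | nil => simp [eval, mulMono]
  | cons b t ih => simp only [mulMono, List.map_cons, eval] at ih ⊢; rw [ih, evalMono_addMono]; push_cast; ring

/-- E3Z checker (evaluation lemmas): `eval_mul` (lane output, transcribed verbatim; see the module docstring). -/
theorem eval_mul (p q : Poly) : eval X (mul p q) = eval X p * eval X q := by
  induction p with
  | nil => simp [eval, mul]
  | cons a t ih => simp only [mul, eval_append, eval_mulMono, ih, eval]; ring

/-- E3Z checker (evaluation lemmas): `eval_sqF` (lane output, transcribed verbatim; see the module docstring). -/
theorem eval_sqF (p : Poly) : eval X (sqF p) = eval X p * eval X p := by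
  induction p with
  | nil => simp [eval, sqF]
  | cons a q ih =>
    simp only [sqF, eval, eval_append, eval_mulMono, ih, evalMono_addMono]; push_cast; ring

/-- E3Z checker (evaluation lemmas): `monoLT_irrefl_eq` (lane output, transcribed verbatim; see the module docstring). -/
theorem monoLT_irrefl_eq (a b : Mono) (h1 : monoLT a b = false) (h2 : monoLT b a = false) : a = b := by
  induction a generalizing b with
  | nil => cases b with
    | nil => rfl
    | cons y b => simp [monoLT] at h1
  | cons x a ih =>
    cases b with
    | nil => simp [monoLT] at h2
    | cons y b =>
      obtain ⟨v, e⟩ := x; obtain ⟨w, e'⟩ := y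
      simp only [monoLT] at h1 h2
      by_cases hvw : v < w
      · simp [hvw] at h1
      · by_cases hwv : w < v
        · simp [hwv] at h2
        · have hv : v = w := by omega
          subst hv
          simp only [lt_self_iff_false, if_false] at h1 h2
          by_cases hee : e < e'
          · simp [hee] at h1
          · by_cases hee' : e' < e
            · simp [hee'] at h2
            · have he : e = e' := by omega
              subst he
              simp only [lt_self_iff_false, if_false] at h1 h2
              exact congrArg _ (ih b h1 h2)

/-- E3Z checker (evaluation lemmas): `eval_mergeF` (lane output, transcribed verbatim; see the module docstring). -/
theorem eval_mergeF (f : ℕ) (p q : Poly) : eval X (mergeF f p q) = eval X p + eval X q := by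
  induction f generalizing p q with
  | zero => simp [mergeF, eval_append]
  | succ f ih =>
    cases p with
    | nil => cases q <;> simp [mergeF, eval]
    | cons a p =>
      cases q with
      | nil => simp [mergeF, eval]
      | cons b q =>
        obtain ⟨a, ca⟩ := a; obtain ⟨b, cb⟩ := b
        simp only [mergeF]
        by_cases h1 : monoLT a b = true
        · rw [if_pos h1]; simp only [eval, ih]; ring
        · rw [if_neg h1]
          by_cases h2 : monoLT b a = true
          · rw [if_pos h2]; simp only [eval, ih]; ring
          · rw [if_neg h2]; simp only [eval, ih]
            have hab : a = b := monoLT_irrefl_eq a b (by simpa using h1) (by simpa using h2)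
            subst hab; push_cast; ring

/-- E3Z checker (evaluation lemmas): `eval_splitAlt` (lane output, transcribed verbatim; see the module docstring). -/
theorem eval_splitAlt (p : Poly) : eval X (splitAlt p).1 + eval X (splitAlt p).2 = eval X p := by
  induction p using splitAlt.induct with
  | case1 => simp [splitAlt, eval]
  | case2 a => simp [splitAlt, eval]
  | case3 a b r ih => simp only [splitAlt, eval]; rw [← ih]; ring

/-- E3Z checker (evaluation lemmas): `eval_msortF` (lane output, transcribed verbatim; see the module docstring). -/
theorem eval_msortF (f : ℕ) (p : Poly) : eval X (msortF f p) = eval X p := by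
  induction f generalizing p with
  | zero => simp [msortF]
  | succ f ih =>
    match p with
    | [] => simp [msortF, eval]
    | [a] => simp [msortF]
    | a :: b :: r =>
      simp only [msortF, eval_mergeF, ih, eval]
      have := eval_splitAlt X r
      rw [← this]; ring

/-- E3Z checker (evaluation lemmas): `eval_msort` (lane output, transcribed verbatim; see the module docstring). -/
theorem eval_msort (p : Poly) : eval X (msort p) = eval X p := eval_msortF X 64 p

/-- E3Z checker (evaluation lemmas): `eval_of_all_zero` (lane output, transcribed verbatim; see the module docstring). -/
theorem eval_of_all_zero (p : Poly) (h : p.all (fun mc => decide (mc.2 = 0)) = true) : eval X p = 0 := by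
  induction p with
  | nil => simp [eval]
  | cons a t ih =>
    simp only [List.all_cons, Bool.and_eq_true, decide_eq_true_eq] at h
    simp only [eval, h.1, ih h.2]; push_cast; ring

/-- E3Z checker (evaluation lemmas): `isZero_sound` (lane output, transcribed verbatim; see the module docstring). -/
theorem isZero_sound (p : Poly) (h : isZero p = true) : eval X p = 0 := by
  rw [← eval_msort]; exact eval_of_all_zero X _ h

/-- E3Z checker (evaluation lemmas): `sum_range_succ'` (lane output, transcribed verbatim; see the module docstring). -/
theorem sum_range_succ' (f : ℕ → ℝ) (n : ℕ) : ((List.range (n + 1)).map f).sum = ((List.range n).map f).sum + f n := by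
  simp [List.range_succ, List.map_append, List.sum_append]

/-- E3Z checker (evaluation lemmas): `sum_range_ite` (lane output, transcribed verbatim; see the module docstring). -/
theorem sum_range_ite (a : ℝ) (j : ℕ) : ∀ n : ℕ, ((List.range n).map (fun k => if j = k then a else 0)).sum = if j < n then a else 0 := by
  intro n
  induction n with
  | zero => simp
  | succ n ih =>
    rw [sum_range_succ', ih]
    by_cases h1 : j < n
    · have h2 : j ≠ n := by omega
      have h3 : j < n + 1 := by omega
      simp [h1, h2, h3]
    · by_cases h2 : j = n
      · subst h2; simp
      · have h3 : ¬ j < n + 1 := by omega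
        simp [h1, h2, h3]

/-- E3Z checker (evaluation lemmas): `vkey_le` (lane output, transcribed verbatim; see the module docstring). -/
theorem vkey_le (nx dim : ℕ) (m : Mono) : vkey nx dim m ≤ dim := by
  unfold vkey; split <;> simp

/-- the slices `k = 0..dim` partition a polynomial: its value is the sum of the slice values -/
theorem eval_slices (nx dim : ℕ) (p : Poly) :
    eval X p = ((List.range (dim + 1)).map (fun k => eval X (sliceOf nx dim k p))).sum := by
  induction p with
  | nil => simp [eval, sliceOf]
  | cons mc p ih =>
    have hsplit : ∀ k, eval X (sliceOf nx dim k (mc :: p)) = (if vkey nx dim mc.1 = k then (mc.2 : ℝ) * evalMono X mc.1 else 0) + eval X (sliceOf nx dim k p) := by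
      intro k; unfold sliceOf; rw [List.filter_cons]
      by_cases h : vkey nx dim mc.1 = k
      · simp [h, eval]
      · simp [h]
    simp only [hsplit]
    rw [List.sum_map_add] 
    · rw [← ih, sum_range_ite, if_pos (Nat.lt_succ_of_le (vkey_le nx dim mc.1))]; simp [eval]

/-- E3Z checker (evaluation lemmas): `eval_zero_of_slices` (lane output, transcribed verbatim; see the module docstring). -/
theorem eval_zero_of_slices (nx dim : ℕ) (p : Poly) (h : ∀ k, k < dim + 1 → isZero (sliceOf nx dim k p) = true) : eval X p = 0 := by
  rw [eval_slices X nx dim p]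
  have : ∀ k ∈ List.range (dim + 1), eval X (sliceOf nx dim k p) = 0 := fun k hk => isZero_sound X _ (h k (List.mem_range.mp hk))
  have h2 : (List.range (dim + 1)).map (fun k => eval X (sliceOf nx dim k p)) = (List.range (dim + 1)).map (fun _ => (0 : ℝ)) :=
    List.map_congr_left this
  rw [h2]; simp

/-- E3Z checker (evaluation lemmas): `eval_sqSum_nonneg` (lane output, transcribed verbatim; see the module docstring). -/
theorem eval_sqSum_nonneg (l : List WSq) (h : allD l = true) : 0 ≤ eval X (sqSum l) := by
  induction l with
  | nil => simp [sqSum, eval]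
  | cons w l ih =>
    simp only [allD, Bool.and_eq_true, decide_eq_true_eq] at h
    simp only [sqSum, eval_append, eval_smul, eval_sqF]
    have h1 : (0 : ℝ) ≤ (w.D : ℝ) * (eval X w.ell * eval X w.ell) :=
      mul_nonneg (by exact_mod_cast h.1) (mul_self_nonneg _)
    linarith [ih h.2]

/-- E3Z checker (evaluation lemmas): `eval_ineqSum_nonneg` (lane output, transcribed verbatim; see the module docstring). -/
theorem eval_ineqSum_nonneg (l : List (Poly × List WSq)) (hD : allDI l = true) (hin : ∀ gi ∈ l, 0 ≤ eval X gi.1) :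
    0 ≤ eval X (ineqSum l) := by
  induction l with
  | nil => simp [ineqSum, eval]
  | cons gi l ih =>
    simp only [allDI, Bool.and_eq_true] at hD
    simp only [ineqSum, eval_append, eval_mul]
    have h1 : 0 ≤ eval X gi.1 := hin gi (by simp)
    have h2 : 0 ≤ eval X (sqSum gi.2) := eval_sqSum_nonneg X gi.2 hD.1
    have h3 := ih hD.2 (fun g hg => hin g (by simp [hg]))
    exact add_nonneg (mul_nonneg h1 h2) h3

/-- E3Z checker (evaluation lemmas): `eval_eqSum_zero` (lane output, transcribed verbatim; see the module docstring). -/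
theorem eval_eqSum_zero (l : List (Poly × Poly)) (hsph : ∀ ew ∈ l, eval X ew.1 = 0) : eval X (eqSum l) = 0 := by
  induction l with
  | nil => simp [eqSum, eval]
  | cons ew l ih =>
    simp only [eqSum, eval_append, eval_mul, hsph ew (by simp), zero_mul, zero_add]
    exact ih (fun e he => hsph e (by simp [he]))

end Poly

end E3Z
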